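import Literature.NumberTheory.LFunctions.ClassGroupLogFreeLemmaB
import Literature.NumberTheory.LFunctions.ClassGroupMeanValue
import Literature.NumberTheory.LFunctions.LogFreeDensityTheorem14
import HarnessLib

/-!
# The sieve side of Théorème 14 for the class group characters of a number field

Topic `Literature/NumberTheory/LFunctions`, namespace `Literature.NumberTheory.LFunctions.NumberField`.
Everything here is PROVED (one definition with body, theorems; no named facts).

Bombieri's Théorème 14 bounds the number of zeros of a FAMILY of `L`-functions by summing the
mean-value lower bounds of Lemme B over the family and comparing with a large-sieve inequality for
the sifted sums (for Dirichlet characters: the tree's `LogFreeDensity.sieveSide`, from the hybrid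
large sieve, Théorème 11).  For the family `{L₀(s, χ)}_{χ ∈ Ĉl_K}` of one number field `K` the
large-sieve input is the log-free mean value theorem `ClassGroupMeanValue.classGroup_meanValue_le`
(Thorner–Zaman 2017, Theorem 4.2, proved in the tree from Weiss's kernel and the squarefree sieve):
with `G` the prime powers `n ∈ (⌊x^{a₀}⌋, ⌊x⌋]` all of whose prime factors exceed `z` and
`S_{χ,v}(t) = Σ_{n ∈ G, n ≤ t} b_n(χ, v)` (`b_n = Λ_χ(n) n^{−1−iv}/n_K`, `coefB`),

* `summatory_coefSiftedB_coefB_eq` — `S_{χ,v}(t) = Σ_𝔫 (Λ(𝔫)/(n_K N𝔫)) χ([𝔫]) N𝔫^{−iv}` over the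
  (prime power) ideals `𝔫` with `N𝔫 ∈ G`, `N𝔫 ≤ t` (`normIdeals`), which are `z`-sifted of norm `> ⌊x^{a₀}⌋`;
* `sieveSide_classGroup` — for `1 ≤ z ≤ ⌊x^{a₀}⌋`, `0 < T'`, `m ≥ n_K + 3`, `(m+1)T'² ≤ 3A²`:
  `Σ_ψ ∫_{−T'}^{T'} ‖S_{ψ,v}(t)‖² dv ≤ 8π h_K M · (1/n_K) Σ_{n ∈ G, n ≤ t} Λ(n) log n / n`,
  `M = meanValueConst K A m z ⌊x^{a₀}⌋` (`Σ_{N𝔫 = n} Λ(𝔫)² ≤ Λ_K(n) log n ≤ n_K Λ(n) log n`).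

## References

* [Bombieri1987GrandCrible] E. Bombieri, Astérisque 18 (1987), §6 Théorème 14 (proof, p. 50).
* [ThornerZaman2017] J. Thorner, A. Zaman, Algebra Number Theory 11 (2017), Theorem 4.2.
-/

noncomputable section

open Complex Metric Set Filter Finset MeasureTheory
open scoped Real Topology LSeries.notation ArithmeticFunction.vonMangoldt

namespace Literature.NumberTheory.LFunctions.NumberField

open Literature.NumberTheory.LFunctions.LogFreeLocal Literature.NumberTheory.LFunctions.LogFreeDensity
  Literature.NumberTheory.LFunctions.WeissKernel Literature.NumberTheory.LFunctions.AbelianDensity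
open scoped nonZeroDivisors _root_.NumberField

variable {K : Type*} [Field K] [NumberField K]

/-! ### The sifted sums as sums over ideals -/

variable (K) in
/-- The ideals whose norm lies in the finite set `G ⊆ ℕ`. [folklore] -/
def normIdeals (G : Finset ℕ) : Finset (Ideal (𝓞 K)) := G.biUnion fun n ↦ idealsOfNorm K n

/-- Membership in `normIdeals`. [folklore] -/
theorem mem_normIdeals {G : Finset ℕ} {I : Ideal (𝓞 K)} : I ∈ normIdeals K G ↔ Ideal.absNorm I ∈ G := by
  rw [normIdeals, Finset.mem_biUnion]
  constructor
  · rintro ⟨n, hn, hI⟩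
    rw [mem_idealsOfNorm] at hI
    rwa [hI]
  · intro h
    exact ⟨_, h, mem_idealsOfNorm.mpr rfl⟩

/-- A sum over `normIdeals K G` is the double sum over norms. [folklore] -/
theorem sum_normIdeals_eq {M : Type*} [AddCommMonoid M] (G : Finset ℕ) (f : Ideal (𝓞 K) → M) :
    ∑ I ∈ normIdeals K G, f I = ∑ n ∈ G, ∑ I ∈ idealsOfNorm K n, f I := by
  rw [normIdeals, Finset.sum_biUnion]
  intro n _ n' _ hnn'
  simp only [Function.onFun]
  rw [Finset.disjoint_left]
  intro I hI hI'
  rw [mem_idealsOfNorm] at hI hI'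
  exact hnn' (hI.symm.trans hI')

/-- `n^{−(1+iv)} = n^{−1} · e^{−(v log n) i}` (`n ≥ 1`). [folklore] -/
theorem natCast_cpow_neg_one_add_mul_I {n : ℕ} (hn : n ≠ 0) (v : ℝ) :
    (n : ℂ) ^ (-(1 + (v : ℂ) * I)) = (n : ℂ)⁻¹ * Complex.exp (-((v : ℂ) * (Real.log n : ℂ)) * I) := by
  have hnC : (n : ℂ) ≠ 0 := by exact_mod_cast hn
  rw [Complex.cpow_def_of_ne_zero hnC]
  have hlog : Complex.log (n : ℂ) = (Real.log n : ℂ) := (Complex.natCast_log).symm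
  rw [hlog, show (Real.log n : ℂ) * -(1 + (v : ℂ) * I) = -(Real.log n : ℂ) + (-((v : ℂ) * (Real.log n : ℂ)) * I) by ring,
    Complex.exp_add, Complex.exp_neg, ← hlog, Complex.exp_log hnC]

/-- **The sifted sum over ideals**: for a class group character `χ`,
`S_{χ,v}(t) = Σ_{𝔫 : N𝔫 ∈ G, N𝔫 ≤ t} (Λ(𝔫)/(n_K N𝔫)) χ([𝔫]) e^{−(v log N𝔫) i}`. [folklore] -/
theorem summatory_coefSiftedB_coefB_eq (χ : ClassGroup (𝓞 K) →* ℂˣ) (v x : ℝ) (z : ℕ) (t : ℝ) :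
    summatory (coefSiftedB (coefB K χ v) x z) t =
      ∑ J ∈ normIdeals K ((siftedSet x z).filter (fun n => n ≤ ⌊t⌋₊)),
        (((idealVonMangoldt J / (Module.finrank ℚ K * Ideal.absNorm J) : ℝ)) : ℂ) * classGroupCharIdealHom χ J *
          Complex.exp (-((v : ℂ) * (Real.log (Ideal.absNorm J) : ℂ)) * Complex.I) := by
  classical
  unfold summatory
  -- restrict to the sifted set
  have h1 : ∀ i ∈ Finset.Icc 0 ⌊t⌋₊, coefSiftedB (coefB K χ v) x z i =
      if i ∈ siftedSet x z then coefB K χ v i else 0 := by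
    intro i _; rfl
  rw [sum_congr rfl h1, ← sum_filter]
  have hset : (Finset.Icc 0 ⌊t⌋₊).filter (fun i ↦ i ∈ siftedSet x z) = (siftedSet x z).filter (fun n ↦ n ≤ ⌊t⌋₊) := by
    ext n; simp only [mem_filter, Finset.mem_Icc, Nat.zero_le, true_and]; tauto
  rw [hset, sum_normIdeals_eq]
  refine Finset.sum_congr rfl fun n hn ↦ ?_
  have hnG := (mem_filter.mp hn).1
  have hn0 : n ≠ 0 := by have := (siftedSet_prop hnG).1; omega
  rw [coefB, twistVonMangoldt, Finset.sum_mul, Finset.sum_div]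
  refine Finset.sum_congr rfl fun J hJ ↦ ?_
  rw [mem_idealsOfNorm] at hJ
  rw [hJ, natCast_cpow_neg_one_add_mul_I hn0 v]
  have hnK : (Module.finrank ℚ K : ℂ) ≠ 0 := by exact_mod_cast (Module.finrank_pos (R := ℚ) (M := K)).ne'
  have hnC : (n : ℂ) ≠ 0 := by exact_mod_cast hn0
  push_cast
  field_simp

/-- The ideals with norm in the sifted set are nonzero, `z`-sifted, of norm `> ⌊x^{a₀}⌋`. [folklore] -/
theorem normIdeals_siftedSet_prop {x : ℝ} {z : ℕ} {t : ℝ} {I : Ideal (𝓞 K)}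
    (hI : I ∈ normIdeals K ((siftedSet x z).filter (fun n => n ≤ ⌊t⌋₊))) :
    I ≠ ⊥ ∧ (⌊x ^ expoB⌋₊ : ℝ) < (Ideal.absNorm I : ℝ) ∧
      ∀ w : IsDedekindDomain.HeightOneSpectrum (𝓞 K), (Ideal.absNorm w.asIdeal : ℝ) ≤ z → ¬ w.asIdeal ∣ I := by
  rw [mem_normIdeals, mem_filter] at hI
  obtain ⟨hG, -⟩ := hI
  obtain ⟨h1, -, hcop⟩ := siftedSet_prop hG
  have hI0 : I ≠ ⊥ := by
    intro h; rw [h, Ideal.absNorm_bot] at h1; omega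
  refine ⟨hI0, by exact_mod_cast h1, fun w hw hdvd ↦ ?_⟩
  -- `N w ∣ N I`, and `N w ≥ 2` is `≤ z`: contradicts coprimality of `N I` with all `m ≤ z`
  have hNw : Ideal.absNorm w.asIdeal ∣ Ideal.absNorm I := map_dvd Ideal.absNorm hdvd
  have hw2 : 2 ≤ Ideal.absNorm w.asIdeal := Literature.NumberTheory.LFunctions.AbelianDensity.two_le_absNorm K w
  have hwz : Ideal.absNorm w.asIdeal ≤ z := by exact_mod_cast hw
  have hc := hcop (Ideal.absNorm w.asIdeal) (mem_Icc.mpr ⟨by omega, hwz⟩)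
  have : Ideal.absNorm w.asIdeal ∣ Nat.gcd (Ideal.absNorm I) (Ideal.absNorm w.asIdeal) :=
    Nat.dvd_gcd hNw dvd_rfl
  rw [hc] at this
  have := Nat.le_of_dvd one_pos this
  omega

/-! ### The sieve side -/

/-- `Σ_{N𝔫 = n} Λ(𝔫)² ≤ n_K Λ(n) log n`. [folklore] -/
theorem sum_idealVonMangoldt_sq_le (n : ℕ) :
    ∑ I ∈ idealsOfNorm K n, idealVonMangoldt I ^ 2 ≤ Module.finrank ℚ K * Λ n * Real.log n := by
  rcases Nat.eq_zero_or_pos n with rfl | hn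
  · have h0 : ∀ I ∈ idealsOfNorm K 0, idealVonMangoldt I ^ 2 = 0 := by
      intro I hI
      rw [mem_idealsOfNorm, Ideal.absNorm_eq_zero_iff] at hI
      rw [hI, idealVonMangoldt_bot]; ring
    rw [Finset.sum_eq_zero h0]; simp
  have hle : ∀ I ∈ idealsOfNorm K n, idealVonMangoldt I ^ 2 ≤ idealVonMangoldt I * Real.log n := by
    intro I hI
    rw [mem_idealsOfNorm] at hI
    have hI0 : I ≠ ⊥ := by intro h; rw [h, Ideal.absNorm_bot] at hI; omega
    have h := idealVonMangoldt_le_log hI0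
    rw [hI] at h
    rw [sq]
    exact mul_le_mul_of_nonneg_left h (idealVonMangoldt_nonneg I)
  calc ∑ I ∈ idealsOfNorm K n, idealVonMangoldt I ^ 2 ≤ ∑ I ∈ idealsOfNorm K n, idealVonMangoldt I * Real.log n :=
        Finset.sum_le_sum hle
    _ = vonMangoldtNorm K n * Real.log n := by rw [vonMangoldtNorm, Finset.sum_mul]
    _ ≤ (Module.finrank ℚ K * Λ n) * Real.log n :=
        mul_le_mul_of_nonneg_right (vonMangoldtNorm_le_finrank_mul n) (Real.log_natCast_nonneg n)
    _ = _ := by ring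

/-- **The sieve side of Théorème 14 for `Ĉl_K`** (in place of Bombieri's Théorème 11): for
`1 ≤ z ≤ ⌊x^{a₀}⌋`, `0 < T'`, `m ≥ n_K + 3`, `(m+1)T'² ≤ 3A²`, and every `t`,
`Σ_ψ ∫_{−T'}^{T'} ‖S_{ψ,v}(t)‖² dv ≤ 8π h_K M (1/n_K) Σ_{n ∈ G, n ≤ t} Λ(n) log n/n`,
`M = meanValueConst K A m z ⌊x^{a₀}⌋`. [cite: ThornerZaman2017, Theorem 4.2] -/
theorem sieveSide_classGroup (x : ℝ) {z : ℕ} (hz1 : 1 ≤ z) (hzx : z ≤ ⌊x ^ expoB⌋₊) {T' A : ℝ} {m : ℕ}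
    (hT : 0 < T') (hA : 0 < A) (hm : Module.finrank ℚ K + 3 ≤ m) (hTA : ((m : ℝ) + 1) * T' ^ 2 ≤ 3 * A ^ 2)
    (t : ℝ) :
    ∑ ψ : AddChar (Additive (ClassGroup (𝓞 K))) ℂ,
        ∫ v in (-T')..T', ‖summatory (coefSiftedB (coefB K (toMulHom ψ).toHomUnits v) x z) t‖ ^ 2 ≤
      8 * π * (Fintype.card (ClassGroup (𝓞 K)) * meanValueConst K A m z ⌊x ^ expoB⌋₊ *
        ((1 / (Module.finrank ℚ K : ℝ)) * ∑ n ∈ (siftedSet x z).filter (fun n => n ≤ ⌊t⌋₊), Λ n * Real.log n / n)) := by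
  classical
  set G := (siftedSet x z).filter (fun n => n ≤ ⌊t⌋₊) with hG
  set Pset := normIdeals K G with hPset
  set b : Ideal (𝓞 K) → ℂ := fun I ↦ (((idealVonMangoldt I / (Module.finrank ℚ K * Ideal.absNorm I) : ℝ)) : ℂ) with hb
  have hz : (1 : ℝ) ≤ z := by exact_mod_cast hz1
  have hzy : (z : ℝ) ≤ (⌊x ^ expoB⌋₊ : ℕ) := by exact_mod_cast hzx
  have hmv := classGroup_meanValue_le Pset b hA hm hT hTA hz hzy
    (fun I hI ↦ (normIdeals_siftedSet_prop hI).1) (fun I hI w hw ↦ (normIdeals_siftedSet_prop hI).2.2 w hw)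
    (fun I hI ↦ (normIdeals_siftedSet_prop hI).2.1)
  -- rewrite our left side into the mean value theorem's
  have hlhs : ∀ ψ : AddChar (Additive (ClassGroup (𝓞 K))) ℂ,
      ∫ v in (-T')..T', ‖summatory (coefSiftedB (coefB K (toMulHom ψ).toHomUnits v) x z) t‖ ^ 2 =
        ∫ v in (-T')..T', ‖∑ I ∈ Pset, b I * ψ (Additive.ofMul (idealClass I)) *
          Complex.exp (-(v * Real.log (Ideal.absNorm I)) * Complex.I)‖ ^ 2 := by
    intro ψ
    refine intervalIntegral.integral_congr fun v _ ↦ ?_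
    rw [summatory_coefSiftedB_coefB_eq]
    congr 2
    refine Finset.sum_congr rfl fun I hI ↦ ?_
    have hI0 := (normIdeals_siftedSet_prop hI).1
    rw [classGroupCharIdealHom_apply_of_ne_bot _ hI0, toHomUnits_toMulHom_apply, ← idealClass_of_ne_bot hI0, hb]
  simp only [hlhs]
  refine hmv.trans ?_
  have hM0 : 0 ≤ (Fintype.card (ClassGroup (𝓞 K)) : ℝ) * meanValueConst K A m z ⌊x ^ expoB⌋₊ :=
    mul_nonneg (Nat.cast_nonneg _) (meanValueConst_nonneg (K := K) A m hz _)
  refine mul_le_mul_of_nonneg_left (mul_le_mul_of_nonneg_left ?_ hM0) (by positivity)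
  -- `Σ_𝔫 N𝔫 |b(𝔫)|² = Σ_n (Σ_{N𝔫=n} Λ(𝔫)²)/(n_K² n) ≤ (1/n_K) Σ_n Λ(n) log n / n`
  have hnK : (0 : ℝ) < Module.finrank ℚ K := by exact_mod_cast Module.finrank_pos (R := ℚ) (M := K)
  rw [hPset, sum_normIdeals_eq, Finset.mul_sum]
  refine Finset.sum_le_sum fun n hn ↦ ?_
  have hn0 : n ≠ 0 := by have := (siftedSet_prop (mem_filter.mp hn).1).1; omega
  have hn0' : (0 : ℝ) < n := by exact_mod_cast Nat.pos_of_ne_zero hn0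
  have hterm : ∀ I ∈ idealsOfNorm K n, (Ideal.absNorm I : ℝ) * ‖b I‖ ^ 2 =
      idealVonMangoldt I ^ 2 / ((Module.finrank ℚ K : ℝ) ^ 2 * n) := by
    intro I hI
    rw [mem_idealsOfNorm] at hI
    rw [hb]; dsimp only
    rw [Complex.norm_real, Real.norm_eq_abs, sq_abs, hI]
    field_simp
  rw [Finset.sum_congr rfl hterm, ← Finset.sum_div]
  have hsq := sum_idealVonMangoldt_sq_le (K := K) n
  rw [div_le_iff₀ (by positivity)]
  calc ∑ I ∈ idealsOfNorm K n, idealVonMangoldt I ^ 2 ≤ Module.finrank ℚ K * Λ n * Real.log n := hsq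
    _ = 1 / (Module.finrank ℚ K : ℝ) * (Λ n * Real.log n / n) * ((Module.finrank ℚ K : ℝ) ^ 2 * n) := by
        field_simp

end Literature.NumberTheory.LFunctions.NumberField

end
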